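import Summits.QuantumFields.YangMills.Theorems.LuscherReductionTwistedTraceScalingFPWeightDetInvariance
import Summits.QuantumFields.YangMills.Theorems.LuscherReductionTwistedTraceScalingSliceCoerciveBased
import Mathlib.Analysis.InnerProductSpace.GramMatrix
import HarnessLib

/-!
# (N3) part 4 — the Gram determinant of the Laplace map, `D₂(p) = normDet(A_p ∘ e)²`, is a SMOOTH, POSITIVE, `Ad`-INVARIANT function of the base point near `0`
# (lane A of S-BASE, crux `TwistedTraceScaling` stmt-QuantumFields-20203, C4 INNER; design note `pub/ym-fleet/ym-luscher-20007-p1/COARSE-DESIGN.md` §23.11 (N3))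

`gramDet p := det(⟪T_p bᵢ, T_p bⱼ⟫)` with `T_p = laplaceMap p ∘ euclToPiₗ` and `b` the standard orthonormal basis of the Euclidean flat coordinates; by Mathlib's
`normDet_sq_eq_det_gram`, `gramDet p = normDet(T_p)²` (★ `gramDet_eq_normDet_sq`), the square of the Gaussian determinant of (N2).  THIS FILE:
* ★ `contDiff_det_pi` — the determinant is `C^∞` on `Fin d → Fin d → ℝ` (Leibniz expansion);
* ★★ `contDiffAt_gramDet` — `gramDet` is `C^k` at `0` for every `k` (`fB` is `C^∞`: `p ↦ fderiv fB (0,p)` is `C^k`, `ContDiffAt.clm_apply`, `.inner`);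
* ★ `gramDet_ad` — `gramDet (Ad_g p) = gramDet p` near `0` (`normDet_laplaceMap_ad`); ★ `gramDet_zero_pos` — `0 < gramDet 0` (coercivity ⇒ `T_0` injective).
The sequel differentiates: the derivative at `0` is `Ad`-invariant, hence zero (`…InvariantFunctional`), hence `|gramDet p − gramDet 0| ≤ K‖p‖²`.
HONEST FRAMING: finite-dimensional calculus for a stub of a child of the CONDITIONAL reduction route R2b1; no spectral claim; C4 OPEN; not a gap, not Clay.
-/

set_option autoImplicit false

noncomputable section

open Filter Topology Real Module
open scoped BigOperators Matrix RealInnerProductSpace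
open Literature.MathematicalPhysics.QuantumFieldTheory
open Literature.MathematicalPhysics.QuantumLattice

namespace Summit.QuantumFields.YangMills.Theorems.FemtoTransferGap.TwoLattice.ConstTube

open Summit.QuantumFields.YangMills.Theorems.FemtoTransferGap
open Summit.QuantumFields.YangMills.Theorems.FemtoTransferGap.TwoLattice.Stiff (LinkSpace)

/-! ## §1 The determinant is smooth -/

/-- ★ The determinant is `C^n` as a function of the entries (`Fin d → Fin d → ℝ`). [folklore] -/
theorem contDiff_det_pi {d : ℕ} {n : WithTop ℕ∞} : ContDiff ℝ n fun M : Fin d → Fin d → ℝ => (Matrix.of M).det := by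
  have h : (fun M : Fin d → Fin d → ℝ => (Matrix.of M).det) =
      fun M => ∑ σ : Equiv.Perm (Fin d), (Equiv.Perm.sign σ : ℝ) * ∏ i, M (σ i) i := by
    funext M; rw [Matrix.det_apply']; rfl
  rw [h]
  refine ContDiff.sum fun σ _ => contDiff_const.mul ?_
  exact contDiff_prod fun i _ => (contDiff_apply ℝ ℝ i).comp (contDiff_apply ℝ (Fin d → ℝ) (σ i))

variable (L : ℕ) [NeZero L]

/-! ## §2 The Gram determinant of the Laplace map -/

/-- The dimension of the Euclidean flat coordinates. [folklore] -/
abbrev flatDim : ℕ := finrank ℝ (EuclideanSpace ℝ (NzSite L × Fin 3))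

/-- The standard orthonormal basis of the Euclidean flat coordinates. [folklore] -/
def flatBasis : OrthonormalBasis (Fin (flatDim L)) ℝ (EuclideanSpace ℝ (NzSite L × Fin 3)) := stdOrthonormalBasis ℝ _

/-- The Laplace map on the Euclidean model: `T_p = laplaceMap p ∘ euclToPiₗ`. [folklore] -/
def laplaceEucl (p : balancedSubmodule L × (Fin 3 → Fin 3 → ℝ)) : EuclideanSpace ℝ (NzSite L × Fin 3) →ₗ[ℝ] LinkSpace L :=
  laplaceMap L p ∘ₗ euclToPiₗ (NzSite L)

/-- The Gram entries `p ↦ ⟪T_p bᵢ, T_p bⱼ⟫` as a function into `Fin d → Fin d → ℝ`. [folklore] -/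
def gramFun (p : balancedSubmodule L × (Fin 3 → Fin 3 → ℝ)) : Fin (flatDim L) → Fin (flatDim L) → ℝ :=
  fun i j => ⟪laplaceEucl L p (flatBasis L i), laplaceEucl L p (flatBasis L j)⟫

/-- ★ The Gram determinant `D₂(p) = det(⟪T_p bᵢ, T_p bⱼ⟫)`. [folklore] -/
def gramDet (p : balancedSubmodule L × (Fin 3 → Fin 3 → ℝ)) : ℝ := (Matrix.of (gramFun L p)).det

/-- ★ `gramDet p = normDet(T_p)²`. [folklore] -/
theorem gramDet_eq_normDet_sq (p : balancedSubmodule L × (Fin 3 → Fin 3 → ℝ)) : gramDet L p = (laplaceEucl L p).normDet ^ 2 := by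
  have h := LinearMap.normDet_sq_eq_det_gram (𝕜 := ℝ) (laplaceEucl L p) (flatBasis L)
  rw [RCLike.ofReal_real_eq_id, id_eq] at h
  rw [h]
  rfl

/-! ## §3 Smoothness at the vacuum base point -/

/-- `p ↦ fderiv fB (0, p)` is `C^k` at `0` for every `k`. [folklore] -/
theorem contDiffAt_fderiv_basedFn {k : WithTop ℕ∞} :
    ContDiffAt ℝ k (fun p : balancedSubmodule L × (Fin 3 → Fin 3 → ℝ) => fderiv ℝ (basedFn L) ((0 : basedSubmodule L), p)) 0 := by
  have h1 : ContDiffAt ℝ k (fderiv ℝ (basedFn L)) ((0 : basedSubmodule L), (0 : balancedSubmodule L × (Fin 3 → Fin 3 → ℝ))) := by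
    have h := (contDiffAt_basedFn L (n := k + 1)).fderiv_right (m := k) le_rfl
    exact h
  have h2 : ContDiffAt ℝ k (fun p : balancedSubmodule L × (Fin 3 → Fin 3 → ℝ) => (((0 : basedSubmodule L), p) : BasedDom L)) 0 :=
    ((ContinuousLinearMap.inr ℝ (basedSubmodule L) (balancedSubmodule L × (Fin 3 → Fin 3 → ℝ))).contDiff).contDiffAt
  exact h1.comp 0 h2

/-- `p ↦ T_p v` is `C^k` at `0` for every fixed `v`. [folklore] -/
theorem contDiffAt_laplaceEucl_apply {k : WithTop ℕ∞} (v : EuclideanSpace ℝ (NzSite L × Fin 3)) :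
    ContDiffAt ℝ k (fun p : balancedSubmodule L × (Fin 3 → Fin 3 → ℝ) => laplaceEucl L p v) 0 := by
  have hform : (fun p : balancedSubmodule L × (Fin 3 → Fin 3 → ℝ) => laplaceEucl L p v) =
      fun p => (gaugeModes L).starProjection ((fderiv ℝ (basedFn L) ((0 : basedSubmodule L), p)) (flatLin L (euclToPiₗ (NzSite L) v), 0)) := by
    funext p; rfl
  rw [hform]
  exact (gaugeModes L).starProjection.contDiff.contDiffAt.comp 0 ((contDiffAt_fderiv_basedFn L (k := k)).clm_apply contDiffAt_const)

/-- The Gram entries are `C^k` at `0`. [folklore] -/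
theorem contDiffAt_gramFun {k : WithTop ℕ∞} : ContDiffAt ℝ k (gramFun L) 0 := by
  refine contDiffAt_pi.mpr fun i => contDiffAt_pi.mpr fun j => ?_
  exact (contDiffAt_laplaceEucl_apply L (k := k) _).inner ℝ (contDiffAt_laplaceEucl_apply L (k := k) _)

/-- ★★ **The Gram determinant is `C^k` at the vacuum base point** for every finite `k`. [folklore] -/
theorem contDiffAt_gramDet {k : WithTop ℕ∞} : ContDiffAt ℝ k (gramDet L) 0 :=
  contDiff_det_pi.contDiffAt.comp 0 (contDiffAt_gramFun L (k := k))

/-! ## §4 Invariance and positivity -/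

/-- ★ `gramDet (Ad_g p) = gramDet p` for `p` near `0`. [folklore] -/
theorem gramDet_ad (g : SU2) : ∀ᶠ p : balancedSubmodule L × (Fin 3 → Fin 3 → ℝ) in 𝓝 0, gramDet L (adParamL L g p) = gramDet L p := by
  filter_upwards [normDet_laplaceMap_ad L g] with p hp
  rw [gramDet_eq_normDet_sq, gramDet_eq_normDet_sq]
  show (laplaceMap L (adParamL L g p) ∘ₗ euclToPiₗ (NzSite L)).normDet ^ 2 = (laplaceMap L p ∘ₗ euclToPiₗ (NzSite L)).normDet ^ 2
  rw [hp]

omit [NeZero L] in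
/-- `euclToPiₗ` is injective. [folklore] -/
theorem euclToPi_injective : Function.Injective (euclToPiₗ (NzSite L)) := fun v w h => by
  ext ya
  have := congrFun (congrFun h ya.1) ya.2
  simpa using this

/-- ★ **The Laplace map at the vacuum base point is injective on the Euclidean model** (coercivity). [folklore] -/
theorem laplaceEucl_zero_injective : Function.Injective (laplaceEucl L 0) := by
  obtain ⟨ε, hε, hC⟩ := exists_uniform_coercive_basedLin L
  intro v w h
  have hlin : laplaceEucl L 0 (v - w) = 0 := by rw [map_sub, h, sub_self]
  have h1 := hC 0 (by rw [norm_zero]; exact hε) (flatLin L (euclToPiₗ (NzSite L) (v - w)))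
  have h2 : (gaugeModes L).starProjection (basedLin L 0 (flatLin L (euclToPiₗ (NzSite L) (v - w)))) = 0 := hlin
  rw [h2, norm_zero, mul_zero] at h1
  have h3 : flatLin L (euclToPiₗ (NzSite L) (v - w)) = 0 := norm_le_zero_iff.mp h1
  have h4 : euclToPiₗ (NzSite L) (v - w) = 0 := by
    have := congrArg (fun ξ : basedSubmodule L => ‖ξ‖) h3
    rw [norm_flatLin, norm_zero] at this
    exact norm_le_zero_iff.mp this.le
  exact sub_eq_zero.mp (euclToPi_injective L (by rw [h4, map_zero]))

/-- ★ `0 < gramDet 0`. [folklore] -/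
theorem gramDet_zero_pos : 0 < gramDet L 0 := by
  rw [gramDet_eq_normDet_sq]
  have h : (laplaceEucl L 0).normDet ≠ 0 := fun h0 =>
    (LinearMap.normDet_eq_zero_iff_ker_ne_bot.mp h0) (LinearMap.ker_eq_bot.mpr (laplaceEucl_zero_injective L))
  positivity

end Summit.QuantumFields.YangMills.Theorems.FemtoTransferGap.TwoLattice.ConstTube

end
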